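import Literature.NumberTheory.GaloisRepresentations.LocalReciprocityLawDischargeProofs
import Literature.NumberTheory.GaloisRepresentations.LocalExistenceTheoremProofs
import Literature.NumberTheory.GaloisRepresentations.LocalWeilDatumValuation
import Literature.AnabelianGeometry.AbsoluteAnabelian.MLFClosureUnitsInfinitelyDivisible
import HarnessLib

/-!
# Norm-unit subgroups of an MLF: EVERY open subgroup of `𝒪_F^×` is `N_{E/F}(𝒪_E^×)` for a finite abelian `E/F`

S. Mochizuki, *Topics in absolute anabelian geometry III* [MochizukiAbsTopIII2015], Def. 3.1 (i)/(iv) p. 66/69: the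
units `𝒪_k̄^×` of an algebraic closure of an MLF `k` and their `G_k`-invariants `𝒪_k^×` — the data on which [IUTchII]
Example 1.8 (iv)'s `G_k`-isometries act.  J.-P. Serre, *Local Fields* [SerreLocalFields1979], Ch. XIV §6 Thm. 1
(the existence theorem: every open subgroup of finite index of `F^*` is a norm group `N_{E/F} E^*`, `E/F` finite
abelian) and Ch. II §2 Prop. 3 / Cor. 4 (the ring of integers of `E` is the integral closure; `|N x| = |x|_E^n`).

THIS FILE (abc-iut cell, seat abc-iut-c312-1, gen 7; the number-theoretic input of «PRINT's Ism is scalar on the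
log-shell», `Summits/ABC/IUTFork/Thm311RealInd2Ism*`) proves the units form of the existence theorem:

* `valuation_norm_eq_one_iff_mem_unitSubmonoid` — for `E/F` finite and `y ∈ E^×`: `N_{E/F}(y)` is a UNIT of `F`
  iff `y` is a unit of `𝒪_F̄` (abc-iut-L4-t2's `unitSubmonoid F F̄`: integral over `𝒪_F` with integral inverse) —
  Serre II §2 Cor. 4 read through the spectral norm (`norm_algebraNorm_eq_spectralNorm_pow`);
* `unitGroup_sup_zpowers_eq_top`, `finiteIndex_subgroupOf_unitGroup`, `finiteIndex_sup_of_sup_eq_top` — bookkeeping: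
  `F^× = 𝒪_F^× · ϖ^ℤ`, open subgroups of the compact `𝒪_F^×` have finite index, so `U₀ · ϖ^ℤ` has finite index;
* **`exists_abelian_norm_unitSubmonoid_eq`** — for every OPEN subgroup `U₀ ≤ 𝒪_F^× ≤ F^×` there is a finite abelian
  `E ⊆ F̄` with `{N_{E/F}(y) : y ∈ E ∩ 𝒪_F̄^×} = U₀` — from the tree's DISCHARGED existence theorem
  `localExistenceTheorem_holds` (Serre XIV §6 Thm. 1) applied to `U₀ · ϖ^ℤ`.

HONEST FRAMING: classical local class field theory; nothing here bears on [IUTchIII] Cor. 3.12.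
-/

set_option autoImplicit false

noncomputable section

namespace Literature.AnabelianGeometry.AbsoluteAnabelian

open _root_.ValuativeRel
open Literature.NumberTheory.GaloisRepresentations

universe u

/-! ## 1. Group-theoretic bookkeeping -/

section Group

variable {G : Type u} [CommGroup G]

/-- If `A ⊔ Z = ⊤` and `B ∩ A` has finite index in `A`, then `B ⊔ Z` has finite index in `G` (the map
`A ⧸ (B ∩ A) → G ⧸ (B ⊔ Z)` is onto). [folklore] -/
private theorem finiteIndex_sup_of_sup_eq_top {A B Z : Subgroup G} (hAZ : A ⊔ Z = ⊤)
    [hfi : (B.subgroupOf A).FiniteIndex] : (B ⊔ Z).FiniteIndex := by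
  have hle : B.subgroupOf A ≤ (B ⊔ Z).comap A.subtype := by
    intro a ha
    exact Subgroup.mem_comap.mpr (Subgroup.mem_sup_left ha)
  let f : A ⧸ B.subgroupOf A →* G ⧸ (B ⊔ Z) := QuotientGroup.map _ _ A.subtype hle
  have hf : Function.Surjective f := by
    intro q
    induction q using QuotientGroup.induction_on with
    | H g =>
      have hg : g ∈ A ⊔ Z := by rw [hAZ]; exact Subgroup.mem_top g
      obtain ⟨a, ha, z, hz, rfl⟩ := Subgroup.mem_sup.mp hg
      refine ⟨QuotientGroup.mk ⟨a, ha⟩, ?_⟩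
      change QuotientGroup.mk (A.subtype ⟨a, ha⟩) = QuotientGroup.mk (a * z)
      rw [QuotientGroup.eq]
      simpa using (Subgroup.mem_sup_right hz : z ∈ B ⊔ Z)
  haveI : Finite (G ⧸ (B ⊔ Z)) := Finite.of_surjective f hf
  exact Subgroup.finiteIndex_of_finite_quotient

end Group

/-! ## 2. Norms of units of a finite extension -/

section Local

variable (F : Type u) [Field F] [ValuativeRel F] [TopologicalSpace F] [IsNonarchimedeanLocalField F]

omit [TopologicalSpace F] [IsNonarchimedeanLocalField F] in
/-- For `a ≠ 0` in a valued field: `v a = 1 ↔ v a ≤ 1 ∧ v a⁻¹ ≤ 1`. [cite: SerreLocalFields1979, Ch. II §1] -/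
theorem valuation_eq_one_iff_le_and_inv_le {a : F} (ha : a ≠ 0) :
    valuation F a = 1 ↔ valuation F a ≤ 1 ∧ valuation F a⁻¹ ≤ 1 := by
  rw [map_inv₀]
  have hpos : 0 < valuation F a := (Valuation.pos_iff _).mpr ha
  constructor
  · intro h; simp [h]
  · rintro ⟨h1, h2⟩
    exact le_antisymm h1 ((inv_le_one₀ hpos).mp h2)

/-- **Norms of units are units, and conversely** (Serre II §2 Cor. 4 `|N x| = |x|_E^{[E:F]}`): for `E/F` finite and
`y ∈ E`, `y ≠ 0`: `v_F(N_{E/F} y) = 1` iff `y ∈ 𝒪_F̄^×` (`y` and `y⁻¹` integral over `𝒪_F`).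
[cite: SerreLocalFields1979, Ch. II §2 Cor. 4] -/
theorem valuation_norm_eq_one_iff_mem_unitSubmonoid (E : IntermediateField F (AlgebraicClosure F))
    [FiniteDimensional F E] {y : E} (hy : y ≠ 0) :
    valuation F (Algebra.norm F y) = 1 ↔ (y : AlgebraicClosure F) ∈ unitSubmonoid F (AlgebraicClosure F) := by
  have hy0 : (y : AlgebraicClosure F) ≠ 0 := fun h => hy (by exact_mod_cast h)
  rw [mem_unitSubmonoid_iff, IntermediateField.isIntegral_coe_iff F (AlgebraicClosure F) E y,
    show ((y : AlgebraicClosure F))⁻¹ = ((y⁻¹ : E) : AlgebraicClosure F) by push_cast; rfl,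
    IntermediateField.isIntegral_coe_iff F (AlgebraicClosure F) E y⁻¹]
  constructor
  · intro hN
    -- `‖N y‖ = 1` for the valuation norm of `F`, hence `spectralNorm y = 1`, hence `y`, `y⁻¹` integral
    letI := IsNonarchimedeanLocalField.nontriviallyNormedField F
    haveI : CompleteSpace F := IsNonarchimedeanLocalField.completeSpace_nontriviallyNormedField F
    haveI : IsUltrametricDist F := IsNonarchimedeanLocalField.isUltrametricDist_nontriviallyNormedField F
    have hn0 : Module.finrank F E ≠ 0 := Module.finrank_pos.ne'
    have key : ∀ z : E, valuation F (Algebra.norm F z) = 1 → IsIntegral 𝒪[F] z := by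
      intro z hz
      have h1 : ‖Algebra.norm F z‖ ≤ 1 :=
        (IsNonarchimedeanLocalField.valuation_le_one_iff_norm_le_one (F := F) _).mp hz.le
      rw [norm_algebraNorm_eq_spectralNorm_pow F E z] at h1
      have h2 : spectralNorm F E z ≤ 1 := by
        by_contra h
        exact absurd h1 (not_le.mpr (one_lt_pow₀ (lt_of_not_ge h) hn0))
      exact (isIntegral_integer_iff_spectralNorm_le_one (w := valuation F) (L := E)
        (IsNonarchimedeanLocalField.valuation_le_one_iff_norm_le_one (F := F))
        (Algebra.IsIntegral.isIntegral z)).mpr h2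
    refine ⟨hy0, key y hN, key y⁻¹ ?_⟩
    have hmul : Algebra.norm F y * Algebra.norm F y⁻¹ = 1 := by
      rw [← map_mul, mul_inv_cancel₀ hy, map_one]
    have : Algebra.norm F y⁻¹ = (Algebra.norm F y)⁻¹ := eq_inv_of_mul_eq_one_right hmul
    rw [this, map_inv₀, hN, inv_one]
  · rintro ⟨-, hi, hii⟩
    have hyO : y ∈ integralClosure 𝒪[F] E := hi
    have hyiO : y⁻¹ ∈ integralClosure 𝒪[F] E := hii
    let u : (integralClosure 𝒪[F] E)ˣ :=
      ⟨⟨y, hyO⟩, ⟨y⁻¹, hyiO⟩, Subtype.ext (mul_inv_cancel₀ hy), Subtype.ext (inv_mul_cancel₀ hy)⟩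
    exact LocalWeilDatum.valuation_norm_unit F E u

/-! ## 3. The units form of the existence theorem -/

omit [TopologicalSpace F] [IsNonarchimedeanLocalField F] in
/-- `U₀ · ϖ^ℤ` meets the unit group in `U₀` (for `U₀ ≤ 𝒪_F^×` and `v ϖ < 1`). [cite: SerreLocalFields1979, Ch. II §1] -/
theorem sup_zpowers_inf_unitGroup {U₀ : Subgroup Fˣ} (hle : U₀ ≤ (valuation F).valuationSubring.unitGroup) {ϖ : Fˣ}
    (hϖ : valuation F (ϖ : F) < 1) {x : Fˣ} (hx : x ∈ U₀ ⊔ Subgroup.zpowers ϖ)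
    (hxu : x ∈ (valuation F).valuationSubring.unitGroup) : x ∈ U₀ := by
  obtain ⟨a, ha, z, hz, rfl⟩ := Subgroup.mem_sup.mp hx
  obtain ⟨n, rfl⟩ := Subgroup.mem_zpowers_iff.mp hz
  have ha1 : valuation F (a : F) = 1 := (Valuation.mem_unitGroup_iff _ _ _).mp (hle ha)
  have h1 : valuation F (((a * ϖ ^ n : Fˣ) : F)) = 1 := (Valuation.mem_unitGroup_iff _ _ _).mp hxu
  rw [Units.val_mul, map_mul, ha1, one_mul, Units.val_zpow_eq_zpow_val, map_zpow₀] at h1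
  have hn : n = 0 := by
    have hinj := (zpow_right_strictAnti₀ ((Valuation.pos_iff _).mpr ϖ.ne_zero) hϖ).injective
    apply hinj
    change valuation F (ϖ : F) ^ n = valuation F (ϖ : F) ^ (0 : ℤ)
    rw [zpow_zero, h1]
  subst hn
  simpa using ha

/-- Every element of `F^×` is a unit times a power of a uniformiser: `𝒪_F^× ⊔ ϖ^ℤ = F^×`.
[cite: SerreLocalFields1979, Ch. II §1] -/
theorem unitGroup_sup_zpowers_eq_top {ϖ : Fˣ} (hϖ : (valuation F).IsUniformizer (ϖ : F)) :
    (valuation F).valuationSubring.unitGroup ⊔ Subgroup.zpowers ϖ = ⊤ := by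
  rw [eq_top_iff]
  intro x _
  -- `v x = v ϖ ^ n` for some `n : ℤ` (the value group is generated by `v ϖ`)
  have hx0 : valuation F (x : F) ≠ 0 := (Valuation.ne_zero_iff _).mpr x.ne_zero
  have hmem : Units.mk0 (valuation F (x : F)) hx0 ∈
      Subgroup.zpowers (Units.mk0 (valuation F (ϖ : F)) hϖ.val_ne_zero) := by
    rw [← hϖ.zpowers_eq_valueGroup]
    exact MonoidWithZeroHom.mem_valueGroup _ ⟨(x : F), by simp⟩
  obtain ⟨n, hn⟩ := Subgroup.mem_zpowers_iff.mp hmem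
  have hval : valuation F (x : F) = valuation F (ϖ : F) ^ n := by
    have := congrArg (fun w : (ValueGroupWithZero F)ˣ => (w : ValueGroupWithZero F)) hn
    simpa [Units.val_zpow_eq_zpow_val] using this.symm
  -- so `u := x ϖ^{-n}` is a unit
  have hu : x * ϖ ^ (-n) ∈ (valuation F).valuationSubring.unitGroup := by
    rw [Valuation.mem_unitGroup_iff, Units.val_mul, map_mul, hval, Units.val_zpow_eq_zpow_val, map_zpow₀, ← zpow_add₀
      hϖ.val_ne_zero, add_neg_cancel, zpow_zero]
  refine Subgroup.mem_sup.mpr ⟨x * ϖ ^ (-n), hu, ϖ ^ n, Subgroup.zpow_mem_zpowers ϖ n, ?_⟩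
  rw [mul_assoc, ← zpow_add, neg_add_cancel, zpow_zero, mul_one]

/-- An open subgroup of the compact group `𝒪_F^×` has finite index in it. [cite: SerreLocalFields1979, Ch. II §1 Prop. 1] -/
theorem finiteIndex_subgroupOf_unitGroup {U₀ : Subgroup Fˣ} (hopen : IsOpen (U₀ : Set Fˣ)) :
    (U₀.subgroupOf ((valuation F).valuationSubring.unitGroup)).FiniteIndex := by
  haveI : CompactSpace ((valuation F).valuationSubring.unitGroup) := isCompact_iff_compactSpace.mp (isCompact_unitGroup F)
  have hop : IsOpen ((U₀.subgroupOf ((valuation F).valuationSubring.unitGroup) : Set ((valuation F).valuationSubring.unitGroup))) :=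
    hopen.preimage continuous_subtype_val
  haveI : DiscreteTopology ((valuation F).valuationSubring.unitGroup ⧸ U₀.subgroupOf ((valuation F).valuationSubring.unitGroup)) :=
    QuotientGroup.discreteTopology hop
  haveI : Finite ((valuation F).valuationSubring.unitGroup ⧸ U₀.subgroupOf ((valuation F).valuationSubring.unitGroup)) := finite_of_compact_of_discrete
  exact Subgroup.finiteIndex_of_finite_quotient

/-- **THE UNITS FORM OF THE EXISTENCE THEOREM**: for every OPEN subgroup `U₀` of the unit group `𝒪_F^×` of a
non-archimedean local field `F` there is a finite abelian extension `E ⊆ F̄` with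
`{N_{E/F}(y) : y ∈ E, y ∈ 𝒪_F̄^×} = U₀`.  Proof: `U := U₀ · ϖ^ℤ` is open of finite index in `F^×`, so `U = N_{E/F}(E^×)`
for a finite abelian `E` (`localExistenceTheorem_holds`, Serre XIV §6 Thm. 1); norms of units are units
(`valuation_norm_eq_one_iff_mem_unitSubmonoid`) and `U ∩ 𝒪_F^× = U₀`.
[cite: SerreLocalFields1979, Ch. XIV §6 Thm. 1] -/
theorem exists_abelian_norm_unitSubmonoid_eq (U₀ : Subgroup Fˣ) (hle : U₀ ≤ (valuation F).valuationSubring.unitGroup)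
    (hopen : IsOpen (U₀ : Set Fˣ)) :
    ∃ E : IntermediateField F (AlgebraicClosure F), FiniteDimensional F E ∧ IsAbelianGalois F E ∧
      ∀ x : Fˣ, x ∈ U₀ ↔ ∃ y : E, (y : AlgebraicClosure F) ∈ unitSubmonoid F (AlgebraicClosure F) ∧
        Algebra.norm F y = (x : F) := by
  obtain ⟨ϖ, hϖ⟩ := exists_units_isUniformizer (F := F)
  set U : Subgroup Fˣ := U₀ ⊔ Subgroup.zpowers ϖ with hU_def
  have hUopen : IsOpen (U : Set Fˣ) := Subgroup.isOpen_mono le_sup_left hopen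
  haveI := finiteIndex_subgroupOf_unitGroup F hopen
  haveI hUfi : U.FiniteIndex :=
    finiteIndex_sup_of_sup_eq_top (unitGroup_sup_zpowers_eq_top F hϖ)
  obtain ⟨E, hfd, hab, hN⟩ := localExistenceTheorem_holds F U hUopen hUfi
  haveI := hfd
  refine ⟨E, hfd, hab, fun x => ?_⟩
  constructor
  · intro hx
    have hxU : x ∈ U := Subgroup.mem_sup_left hx
    rw [← hN] at hxU
    obtain ⟨y, hy⟩ := hxU
    have hy0 : (y : E) ≠ 0 := y.ne_zero
    refine ⟨(y : E), ?_, ?_⟩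
    · rw [← valuation_norm_eq_one_iff_mem_unitSubmonoid F E hy0]
      have : Algebra.norm F (y : E) = (x : F) := by
        have := congrArg (fun w : Fˣ => (w : F)) hy
        simpa using this
      rw [this]
      exact (Valuation.mem_unitGroup_iff _ _ _).mp (hle hx)
    · have := congrArg (fun w : Fˣ => (w : F)) hy
      simpa using this
  · rintro ⟨y, hy, hyx⟩
    have hy0 : y ≠ 0 := by
      rintro rfl
      rw [Algebra.norm_zero] at hyx
      exact x.ne_zero hyx.symm
    have hv : valuation F (x : F) = 1 := by
      rw [← hyx]
      exact (valuation_norm_eq_one_iff_mem_unitSubmonoid F E hy0).mpr hy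
    have hxU : x ∈ U := by
      rw [← hN]
      refine ⟨Units.mk0 y hy0, Units.ext ?_⟩
      simpa using hyx
    exact sup_zpowers_inf_unitGroup F hle hϖ.val_lt_one hxU ((Valuation.mem_unitGroup_iff _ _ _).mpr hv)

end Local

end Literature.AnabelianGeometry.AbsoluteAnabelian

end
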